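import Literature.Algebra.Polynomial.PadicCubicRootCount
import Literature.NumberTheory.EllipticCurves.BinaryQuarticStabilizerTorsion
import Literature.NumberTheory.EllipticCurves.BhargavaShankarLocalMassesProofs
import Literature.NumberTheory.EllipticCurves.BinaryQuarticLocalSolubility
import HarnessLib

/-!
# `#Stab_{PGL₂(ℚ_p)}(f) = #E_{I,J}(ℚ_p)[2]` is locally constant in `f ∈ V_{ℤ_p}` (off `Δ = 0`)
# and in `(I, J) ∈ ℤ_p²` (off `4I³ = J²`)

`Proofs` companion (theorems only: no definitions, no named facts) of `BinaryQuarticStabilizer.lean`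
/ `BinaryQuarticStabilizerTorsion.lean` (Bhargava–Shankar's Lemma 5.11 of `arXiv:1006.1002v2` =
Thm 3.2 of the published version: `#Stab_{PGL₂(K)}(f) = 1 + #{φ ∈ K : φ³ − 3I(f)φ + J(f) = 0}
= #E_{I,J}(K)[2]`) and `BhargavaShankarLocalMasses.lean` (`curveOfInvariants`, the integrand
`localSelmerRatio` of the local masses `M_p(V,F)` of Prop. 5.12 / Prop. 3.9). Using the local
constancy of the number of `ℤ_p`-roots of a depressed cubic
(`Literature.Algebra.Polynomial.eventually_ncard_roots_eq`):

* `norm_le_one_of_cubic_root` — `ℚ_p`-roots of a monic `ℤ_p`-cubic lie in `ℤ_p`;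
  `ncard_resolventRoots_map_eq` — the `ℚ_p`-rational roots of the resolvent of `f ∈ V_{ℤ_p}` are
  counted by `{s ∈ ℤ_p : s³ − 3I(f)s + J(f) = 0}`;
* `BinaryQuartic.eventually_pgl2StabilizerCard_map_eq` — **`f ↦ #Stab_{PGL₂(ℚ_p)}(f)` is locally
  constant on `{Δ ≠ 0} ⊆ V_{ℤ_p}`**;
* `eventually_natCard_torsionBy_two_curveOfInvariants_eq` — **`(I, J) ↦ #E_{I,J}(ℚ_p)[2]` is
  locally constant on `{4I³ ≠ J²} ⊆ ℤ_p²`** (the `2`-division cubic `x³ − (I/3)x − J/27` having the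
  roots `φ/3`, `φ³ − 3Iφ − J = 0`).

These are the regularity statements that let the `p`-adic masses of Bhargava–Shankar's Prop. 3.9
(published version; Prop. 5.12 of the arXiv text) be evaluated fibre by fibre over small balls of
invariants, on which the number of `PGL₂(ℚ_p)`-classes and their stabilisers are then constant.

## References

* M. Bhargava, A. Shankar, Ann. of Math. (2) 181 (2015) 191–242, Lemma 5.11 / Prop. 5.12 of
  arXiv:1006.1002v2 (Thm 3.2 / Prop. 3.9 of the published version). [cite: BhargavaShankarAnnals2015, Lemma 5.11 and Prop. 5.12 (arXiv:1006.1002v2 numbering)]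
-/

noncomputable section

open scoped Classical Topology
open Filter Literature.Algebra.Polynomial

namespace Literature.NumberTheory.EllipticCurves

section Padic

variable {p : ℕ} [Fact p.Prime]

/-- **Roots of a monic integral cubic are integral**: if `s ∈ ℚ_p` satisfies `s³ + as + b = 0` with
`a, b ∈ ℤ_p` then `|s|_p ≤ 1`. [folklore] -/
theorem norm_le_one_of_cubic_root {a b : ℤ_[p]} {s : ℚ_[p]} (hs : s ^ 3 + (a : ℚ_[p]) * s + b = 0) : ‖s‖ ≤ 1 := by
  by_contra hgt
  push Not at hgt
  have hspos : 0 < ‖s‖ := lt_trans zero_lt_one hgt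
  -- `‖as + b‖ ≤ ‖s‖ < ‖s‖³`
  have h1 : ‖(a : ℚ_[p]) * s + b‖ ≤ ‖s‖ := by
    refine (Padic.nonarchimedean _ _).trans (max_le ?_ ?_)
    · rw [norm_mul, PadicInt.padic_norm_e_of_padicInt]
      exact mul_le_of_le_one_left hspos.le (PadicInt.norm_le_one a)
    · rw [PadicInt.padic_norm_e_of_padicInt]
      exact (PadicInt.norm_le_one b).trans hgt.le
  have h2 : ‖s‖ < ‖s ^ 3‖ := by
    rw [norm_pow]
    have hsq : 1 < ‖s‖ ^ 2 := one_lt_pow₀ hgt two_ne_zero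
    calc ‖s‖ = ‖s‖ * 1 := (mul_one _).symm
      _ < ‖s‖ * ‖s‖ ^ 2 := mul_lt_mul_of_pos_left hsq hspos
      _ = ‖s‖ ^ 3 := by ring
  have hne : ‖s ^ 3‖ ≠ ‖(a : ℚ_[p]) * s + b‖ := (ne_of_gt (lt_of_le_of_lt h1 h2))
  have := Padic.add_eq_max_of_ne hne
  rw [show s ^ 3 + ((a : ℚ_[p]) * s + b) = s ^ 3 + (a : ℚ_[p]) * s + b by ring, hs, norm_zero] at this
  have : ‖s ^ 3‖ ≤ 0 := by rw [this]; exact le_max_left _ _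
  exact absurd (norm_nonneg (s ^ 3) |>.antisymm this |>.symm) (by rw [norm_pow]; positivity)

/-- The `ℚ_p`-roots of `x³ + ax + b` (`a, b ∈ ℤ_p`) are in bijection with its `ℤ_p`-roots; in
particular the two root sets have the same size. [folklore] -/
theorem ncard_setOf_cubic_root_coe_eq (a b : ℤ_[p]) :
    {s : ℚ_[p] | s ^ 3 + (a : ℚ_[p]) * s + b = 0}.ncard = {s : ℤ_[p] | s ^ 3 + a * s + b = 0}.ncard := by
  have heq : {s : ℚ_[p] | s ^ 3 + (a : ℚ_[p]) * s + b = 0} =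
      ((↑) : ℤ_[p] → ℚ_[p]) '' {s : ℤ_[p] | s ^ 3 + a * s + b = 0} := by
    ext s
    simp only [Set.mem_setOf_eq, Set.mem_image]
    constructor
    · intro hs
      refine ⟨⟨s, norm_le_one_of_cubic_root hs⟩, ?_, rfl⟩
      apply Subtype.coe_injective
      push_cast
      exact hs
    · rintro ⟨t, ht, rfl⟩
      have := congrArg ((↑) : ℤ_[p] → ℚ_[p]) ht
      push_cast at this
      exact this
  rw [heq, Set.ncard_image_of_injective _ (fun x y h ↦ Subtype.coe_injective h)]
  rfl

namespace BinaryQuartic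

/-- The rational roots of the resolvent of the image of `f ∈ V_{ℤ_p}` in `V_{ℚ_p}` are counted by the
`ℤ_p`-roots of `s³ − 3I(f)s + J(f)`. [folklore] -/
theorem ncard_resolventRoots_map_eq (f : BinaryQuartic ℤ_[p]) :
    (resolventRoots (f.map PadicInt.Coe.ringHom)).ncard = {s : ℤ_[p] | s ^ 3 + (-3 * f.I) * s + f.J = 0}.ncard := by
  rw [← ncard_setOf_cubic_root_coe_eq]
  congr 1
  ext φ
  have hc3 : ((3 : ℤ_[p]) : ℚ_[p]) = 3 := rfl
  have hcoef : ((-3 * f.I : ℤ_[p]) : ℚ_[p]) = -3 * (f.I : ℚ_[p]) := by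
    rw [PadicInt.coe_mul, PadicInt.coe_neg, hc3]
  simp only [resolventRoots, Set.mem_setOf_eq, I_map, J_map, hcoef]
  change φ ^ 3 - 3 * (f.I : ℚ_[p]) * φ + (f.J : ℚ_[p]) = 0 ↔ φ ^ 3 + -3 * (f.I : ℚ_[p]) * φ + (f.J : ℚ_[p]) = 0
  constructor <;> intro h <;> linear_combination h

/-- **`#Stab_{PGL₂(ℚ_p)}(f)` is locally constant on `{Δ ≠ 0} ⊆ V_{ℤ_p}`.**
[cite: BhargavaShankarAnnals2015, Lemma 5.11 (arXiv:1006.1002v2 numbering)] -/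
theorem eventually_pgl2StabilizerCard_map_eq (f : BinaryQuartic ℤ_[p]) (hΔ : f.disc ≠ 0) :
    ∀ᶠ f' in 𝓝 f, pgl2StabilizerCard (f'.map PadicInt.Coe.ringHom) = pgl2StabilizerCard (f.map PadicInt.Coe.ringHom) := by
  have h2 : (2 : ℚ_[p]) ≠ 0 := by norm_num
  have h3 : (3 : ℚ_[p]) ≠ 0 := by norm_num
  have hD : 4 * (-3 * f.I) ^ 3 + 27 * f.J ^ 2 ≠ 0 := by
    have h27 := twentySeven_mul_disc f
    intro h0
    apply hΔ
    have : (27 : ℤ_[p]) * (27 * f.disc) = 0 := by rw [h27]; linear_combination -h0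
    simpa using this
  -- `Δ ≠ 0` and the root count are both locally constant
  have hopen : ∀ᶠ f' in 𝓝 f, f'.disc ≠ 0 :=
    (isOpen_ne_fun continuous_disc continuous_const).mem_nhds hΔ
  have hcont : ContinuousAt (fun g : BinaryQuartic ℤ_[p] ↦ (-3 * g.I, g.J)) f := by
    refine Continuous.continuousAt ?_
    simp only [I, J]
    fun_prop
  have hroots := hcont.eventually (eventually_ncard_roots_eq hD)
  filter_upwards [hopen, hroots] with f' hΔ' hr'
  have hΔQ : (f.map PadicInt.Coe.ringHom).disc ≠ 0 := by
    rw [disc_map]; exact fun h ↦ hΔ (PadicInt.coe_eq_zero.mp h)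
  have hΔQ' : (f'.map PadicInt.Coe.ringHom).disc ≠ 0 := by
    rw [disc_map]; exact fun h ↦ hΔ' (PadicInt.coe_eq_zero.mp h)
  rw [pgl2StabilizerCard_eq h2 h3 hΔQ, pgl2StabilizerCard_eq h2 h3 hΔQ', ncard_resolventRoots_map_eq,
    ncard_resolventRoots_map_eq]
  exact congrArg _ hr'

end BinaryQuartic

/-- `#E_{I,J}(ℚ_p)[2] = 1 + #{s ∈ ℤ_p : s³ − 3Is − J = 0}` (`x = s/3` runs over the rational
`2`-division points `x³ − (I/3)x − J/27 = 0`), for `4I³ ≠ J²`.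
[cite: BhargavaShankarAnnals2015, Lemma 5.11 (E_{I,J}[2]; arXiv:1006.1002v2 numbering)] -/
theorem natCard_torsionBy_two_curveOfInvariants_eq {IJ : ℤ_[p] × ℤ_[p]} (h : 4 * IJ.1 ^ 3 - IJ.2 ^ 2 ≠ 0) :
    Nat.card (AddSubgroup.torsionBy (curveOfInvariants ℚ_[p] (IJ.1 : ℚ_[p]) (IJ.2 : ℚ_[p])).toAffine.Point (2 : ℤ)) =
      {s : ℤ_[p] | s ^ 3 + (-3 * IJ.1) * s + (-IJ.2) = 0}.ncard + 1 := by
  haveI := isElliptic_curveOfInvariants p h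
  have h2 : (2 : ℚ_[p]) ≠ 0 := by norm_num
  have h3 : (3 : ℚ_[p]) ≠ 0 := by norm_num
  rw [WeierstrassCurve.natCard_torsionBy_two_eq _ h2, ← ncard_setOf_cubic_root_coe_eq]
  congr 1
  -- roots `x` of `x³ − (I/3)x − J/27` ↔ roots `s = 3x` of `s³ − 3Is − J`
  have hc3 : ((3 : ℤ_[p]) : ℚ_[p]) = 3 := rfl
  have hcoefA : ((-3 * IJ.1 : ℤ_[p]) : ℚ_[p]) = -3 * (IJ.1 : ℚ_[p]) := by
    rw [PadicInt.coe_mul, PadicInt.coe_neg, hc3]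
  have hcoefB : ((-IJ.2 : ℤ_[p]) : ℚ_[p]) = -(IJ.2 : ℚ_[p]) := PadicInt.coe_neg _
  have heq : {s : ℚ_[p] | s ^ 3 + ((-3 * IJ.1 : ℤ_[p]) : ℚ_[p]) * s + ((-IJ.2 : ℤ_[p]) : ℚ_[p]) = 0} =
      (fun x : ℚ_[p] ↦ 3 * x) '' {x : ℚ_[p] | (curveOfInvariants ℚ_[p] (IJ.1 : ℚ_[p]) (IJ.2 : ℚ_[p])).twoTorsionPolynomial.toPoly.IsRoot x} := by
    ext s
    simp only [Set.mem_setOf_eq, Set.mem_image, curveOfInvariants,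
      WeierstrassCurve.isRoot_twoTorsionPolynomial_short_iff h2, hcoefA, hcoefB]
    constructor
    · intro hs
      refine ⟨s / 3, ?_, by field_simp⟩
      have : (s / 3) ^ 3 + -(IJ.1 : ℚ_[p]) / 3 * (s / 3) + -(IJ.2 : ℚ_[p]) / 27 =
          (1 / 27) * (s ^ 3 + -3 * (IJ.1 : ℚ_[p]) * s + -(IJ.2 : ℚ_[p])) := by ring
      rw [this, hs, mul_zero]
    · rintro ⟨x, hx, rfl⟩
      have : (3 * x) ^ 3 + -3 * (IJ.1 : ℚ_[p]) * (3 * x) + -(IJ.2 : ℚ_[p]) =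
          27 * (x ^ 3 + -(IJ.1 : ℚ_[p]) / 3 * x + -(IJ.2 : ℚ_[p]) / 27) := by ring
      rw [this, hx, mul_zero]
  rw [heq, Set.ncard_image_of_injective _ (mul_right_injective₀ h3)]

/-- **`(I, J) ↦ #E_{I,J}(ℚ_p)[2]` is locally constant on `{4I³ ≠ J²} ⊆ ℤ_p²`.**
[cite: BhargavaShankarAnnals2015, Lemma 5.11 and Prop. 5.12 (arXiv:1006.1002v2 numbering)] -/
theorem eventually_natCard_torsionBy_two_curveOfInvariants_eq {IJ : ℤ_[p] × ℤ_[p]} (h : 4 * IJ.1 ^ 3 - IJ.2 ^ 2 ≠ 0) :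
    ∀ᶠ IJ' : ℤ_[p] × ℤ_[p] in 𝓝 IJ,
      Nat.card (AddSubgroup.torsionBy (curveOfInvariants ℚ_[p] (IJ'.1 : ℚ_[p]) (IJ'.2 : ℚ_[p])).toAffine.Point (2 : ℤ)) =
      Nat.card (AddSubgroup.torsionBy (curveOfInvariants ℚ_[p] (IJ.1 : ℚ_[p]) (IJ.2 : ℚ_[p])).toAffine.Point (2 : ℤ)) := by
  have hD : 4 * (-3 * IJ.1) ^ 3 + 27 * (-IJ.2) ^ 2 ≠ 0 := by
    intro h0
    have h27 : (27 : ℤ_[p]) * (4 * IJ.1 ^ 3 - IJ.2 ^ 2) = 0 := by linear_combination -h0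
    exact h ((mul_eq_zero.mp h27).resolve_left (by norm_num))
  have hopen : ∀ᶠ IJ' : ℤ_[p] × ℤ_[p] in 𝓝 IJ, 4 * IJ'.1 ^ 3 - IJ'.2 ^ 2 ≠ 0 :=
    (isOpen_ne_fun (by fun_prop) continuous_const).mem_nhds h
  have hcont : ContinuousAt (fun IJ' : ℤ_[p] × ℤ_[p] ↦ (-3 * IJ'.1, -IJ'.2)) IJ :=
    Continuous.continuousAt (by fun_prop)
  have hroots := hcont.eventually (eventually_ncard_roots_eq hD)
  filter_upwards [hopen, hroots] with IJ' h' hr'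
  rw [natCard_torsionBy_two_curveOfInvariants_eq h, natCard_torsionBy_two_curveOfInvariants_eq h']
  exact congrArg (· + 1) hr'

end Padic

end Literature.NumberTheory.EllipticCurves

end
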